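import Mathlib.Algebra.CharZero.Infinite
import Summits.ValiantsHypothesis.ValiantsHypothesis.Theorems.GrenetZeonDualUnipotentThreeHalvesHeavyTopNilIndexTower
import Summits.ValiantsHypothesis.ValiantsHypothesis.Theorems.GrenetZeonDualUnipotentThreeHalvesHeavyTopCodimOneClassification
import Summits.ValiantsHypothesis.ValiantsHypothesis.Theorems.GrenetZeonDualUnipotentThreeHalvesHeavyTopCodimOneSqNeZero

/-!
# `GrenetZeon.DualUnipotentThreeHalves` (stmt-ValiantsHypothesis-24318), R2 heavy-top instrument — THE NILINDEX COROLLARY of COROLLARY II: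
# a nilpotent space of `m × m` matrices of dimension `C(m,2) − 1` and nilindex `≤ m − 1` is conjugate ONTO a coordinate hyperplane
# `𝔫_m ∖ {E_{i,i+1}}` of the strictly upper triangular matrices

Experiment cell «val-heavytop-census» (D-0160), engine seat val-htc-eng-2 g6 (MAINTENANCE chore (i) of director R524-htc; lead EXTREMISERS X16
reading R-d1: «the Macdonald–MacDougall–Sweet equality spaces at nilindex `m − 1` are exactly the conjugates of `𝔫_m ∖ {E_{i,i+1}}`»).  Second of two files.

**Theorem** (`nilIndex_codimOne_classification`).  Let `m ≥ 2`, `V ≤ M_m(ℂ)` a linear space with `A ^ (m − 1) = 0` for every `A ∈ V` and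
`dim V = C(m,2) − 1`.  Then there are a unit `P` and consecutive indices `i, j = i + 1` with `A ∈ V ↔ P A P⁻¹ ∈ 𝔫_m ∧ (P A P⁻¹)_{ij} = 0`,
i.e. `P V P⁻¹` IS the coordinate hyperplane `H_i = {A ∈ 𝔫_m : A_{i,i+1} = 0}`.  Conversely (`finrank_nt_inf_ker_entry`, `pow_eq_zero_of_superdiag_eq_zero`)
every `H_i` is such a space, so the statement is sharp.

Proof.  By ✓ `codimOne_classification` (COROLLARY II, p722829) `V` is conjugate into `𝔫_m` or onto a tower `T(p, I, q)`; towers contain an element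
of nilindex `m` (✓ `exists_pow_ne_zero_of_tower_form`, sibling file `…HeavyTopNilIndexTower`, with ✓ `exists_sq_ne_zero_of_irreducible`), so the
second branch is excluded.  In the first branch `U := P V P⁻¹` is a hyperplane of `𝔫_m` on which `A ↦ (A ^ (m−1))_{1m} = ∏_i A_{i,i+1}`
vanishes (`pow_apply_zero_eq_prod`); if every superdiagonal coordinate were non-zero somewhere on `U`, a common good vector would exist
(`exists_mem_forall_superdiag_ne_zero` — finitely many bad scalars on a line, `ℂ` infinite), contradiction; so `U ≤ H_i` for some `i`, and
`dim H_i = C(m,2) − 1 = dim U` forces equality.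

* `pow_apply_zero_eq_prod`, `pow_eq_zero_iff_prod_superdiag_eq_zero`, `pow_eq_zero_of_superdiag_eq_zero` — the top-right entry of `A ^ (m−1)` on `𝔫_m`;
* `exists_mem_forall_superdiag_ne_zero` — avoidance of finitely many coordinate hyperplanes inside a subspace;
* `mem_nt_inf_ker_entry`, `nt_inf_ker_entry_lt_nt`, `finrank_nt_inf_ker_entry` — the coordinate hyperplane `H_i` (as `𝔫 ⊓ ker (entry i (i+1))`);
* ★ `strictUpper_hyperplane_of_pow_eq_zero` — hyperplanes of `𝔫_{k+1}` of nilindex `≤ k` are the `H_i`;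
* `towerHull_exists_pow_ne_zero_of_irreducible` — the irreducible-plane form of the sibling file's tower lemma;
* ★★ `nilIndex_codimOne_classification` — the corollary.

Honest framing: enemy-side structure (classification of extremal configurations) for the census instrument; 0 GRID cells; nothing here proves or refutes
`HeavyTopLaw`, 24318, S3b or 8062; `VP ≠ VNP` is NOT proved.  No definitions, no named facts.
[folklore linear algebra over val-idea-30 MEMO codim-one COROLLARY II (kernel p722829); lead CENSUS-EXTREMISERS X16 R-d1; this cell]
-/

noncomputable section

-- single-conjunct layout: Sub = Summit, duplicated namespace component intended
set_option linter.dupNamespace false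

namespace Summit.ValiantsHypothesis.ValiantsHypothesis.Theorems.GrenetZeon.HeavyTopNilIndexCodimOne

open Matrix
open Summit.ValiantsHypothesis.ValiantsHypothesis.Theorems.GrenetZeon.HeavyTopTowerDefs (towerHull)
open Summit.ValiantsHypothesis.ValiantsHypothesis.Theorems.GrenetZeon.HeavyTopNilIndexTower (towerHull_exists_pow_ne_zero conj_pow
  exists_pow_ne_zero_of_tower_form)
open Summit.ValiantsHypothesis.ValiantsHypothesis.Theorems.GrenetZeon.HeavyTopCodimOneClassification (codimOne_classification)
open Summit.ValiantsHypothesis.ValiantsHypothesis.Theorems.GrenetZeon.HeavyTopCodimOneBlocks (exists_sq_ne_zero_of_irreducible)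
open Literature.LinearAlgebra.Matrix (IsStrictUpper)
open Literature.LinearAlgebra.Matrix.GerstenhaberNilpotentSubspace (nt mem_nt_iff_isStrictUpper finrank_nt conjEquiv)

/-! ## The top-right entry of `A ^ j` on `𝔫` is the product of the superdiagonal entries -/

/-- For strictly upper triangular `A` of size `k + 1`: `(A ^ j)_{0, j} = ∏_{t < j} A_{t, t+1}` (`j ≤ k`). [folklore] -/
theorem pow_apply_zero_eq_prod {k : ℕ} (A : Matrix (Fin (k + 1)) (Fin (k + 1)) ℂ) (hA : IsStrictUpper A) :
    ∀ (j : ℕ) (hj : j ≤ k), (A ^ j) 0 ⟨j, by omega⟩ = ∏ t : Fin j, A ⟨t, by omega⟩ ⟨t + 1, by omega⟩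
  | 0, _ => by simp
  | j + 1, hj => by
    rw [pow_succ, Matrix.mul_apply, Finset.sum_eq_single ⟨j, by omega⟩, pow_apply_zero_eq_prod A hA j (by omega),
      Fin.prod_univ_castSucc]
    · rfl
    · intro l _ hl
      by_cases hlt : (l : ℕ) < j
      · rw [hA.pow_apply_eq_zero j 0 l (by rw [Fin.val_zero]; omega), zero_mul]
      · have hne : (l : ℕ) ≠ j := fun h => hl (Fin.ext h)
        rw [hA l _ (Fin.le_def.2 (by dsimp only; omega)), mul_zero]
    · intro h; exact absurd (Finset.mem_univ _) h

/-- For strictly upper triangular `A` of size `k + 1`: `A ^ k = 0 ↔ ∏_{t < k} A_{t,t+1} = 0`. [folklore] -/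
theorem pow_eq_zero_iff_prod_superdiag_eq_zero {k : ℕ} (A : Matrix (Fin (k + 1)) (Fin (k + 1)) ℂ) (hA : IsStrictUpper A) :
    A ^ k = 0 ↔ ∏ t : Fin k, A t.castSucc t.succ = 0 := by
  have key : (A ^ k) 0 (Fin.last k) = ∏ t : Fin k, A t.castSucc t.succ := pow_apply_zero_eq_prod A hA k le_rfl
  constructor
  · intro h; rw [← key, h, Matrix.zero_apply]
  · intro h
    ext a b
    rw [Matrix.zero_apply]
    by_cases hb : (b : ℕ) < a + k
    · exact hA.pow_apply_eq_zero k a b hb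
    · have ha : a = 0 := Fin.ext (by rw [Fin.val_zero]; omega)
      have hb' : b = Fin.last k := Fin.ext (by rw [Fin.val_last]; omega)
      subst ha; subst hb'
      rw [key, h]

/-- Each coordinate hyperplane `{A ∈ 𝔫_{k+1} : A_{t,t+1} = 0}` has nilindex `≤ k`. [folklore] -/
theorem pow_eq_zero_of_superdiag_eq_zero {k : ℕ} (A : Matrix (Fin (k + 1)) (Fin (k + 1)) ℂ) (hA : IsStrictUpper A) (t : Fin k)
    (ht : A t.castSucc t.succ = 0) : A ^ k = 0 :=
  (pow_eq_zero_iff_prod_superdiag_eq_zero A hA).2 (Finset.prod_eq_zero (Finset.mem_univ t) ht)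

/-! ## Avoiding finitely many coordinate hyperplanes inside a subspace -/

/-- If each of the superdiagonal coordinates `A ↦ A_{t,t+1}` (`t < k`) is non-zero somewhere on the subspace `U`, then (for every `n`) some
`A ∈ U` has `A_{t,t+1} ≠ 0` for all `t < n` — a line `A + c B` meets each coordinate hyperplane in at most one `c`, and `ℂ` is infinite. [folklore] -/
theorem exists_mem_forall_superdiag_ne_zero {k : ℕ} (U : Submodule ℂ (Matrix (Fin (k + 1)) (Fin (k + 1)) ℂ))
    (h : ∀ t : Fin k, ∃ A ∈ U, A t.castSucc t.succ ≠ 0) :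
    ∀ n : ℕ, ∃ A ∈ U, ∀ t : Fin k, (t : ℕ) < n → A t.castSucc t.succ ≠ 0
  | 0 => ⟨0, U.zero_mem, fun t ht => absurd ht (Nat.not_lt_zero _)⟩
  | n + 1 => by
    classical
    obtain ⟨A, hA, hAn⟩ := exists_mem_forall_superdiag_ne_zero U h n
    by_cases hn : n < k
    · obtain ⟨B, hB, hBn⟩ := h ⟨n, hn⟩
      -- avoid the finitely many bad scalars `-A_{t,t+1} / B_{t,t+1}`
      obtain ⟨c, hc⟩ := Infinite.exists_notMem_finset
        (Finset.univ.image fun t : Fin k => -A t.castSucc t.succ / B t.castSucc t.succ)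
      refine ⟨A + c • B, U.add_mem hA (U.smul_mem c hB), fun t ht h0 => ?_⟩
      rw [Matrix.add_apply, Matrix.smul_apply, smul_eq_mul] at h0
      by_cases hBt : B t.castSucc t.succ = 0
      · rw [hBt, mul_zero, add_zero] at h0
        by_cases htn : (t : ℕ) < n
        · exact hAn t htn h0
        · have : t = ⟨n, hn⟩ := Fin.ext (by dsimp only; omega)
          subst this
          exact hBn hBt
      · refine hc (Finset.mem_image.2 ⟨t, Finset.mem_univ _, ?_⟩)
        rw [eq_comm, eq_div_iff hBt]
        linear_combination h0
    · exact ⟨A, hA, fun t _ => hAn t (by omega)⟩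

/-! ## The coordinate hyperplane `H_t = 𝔫 ⊓ ker (A ↦ A_{t,t+1})` -/

/-- Membership in `H_t`. [folklore] -/
theorem mem_nt_inf_ker_entry {k : ℕ} (t : Fin k) (A : Matrix (Fin (k + 1)) (Fin (k + 1)) ℂ) :
    A ∈ nt ℂ (k + 1) ⊓ LinearMap.ker (Matrix.entryLinearMap ℂ ℂ (Fin.castSucc t) (Fin.succ t)) ↔
      IsStrictUpper A ∧ A t.castSucc t.succ = 0 := by
  rw [Submodule.mem_inf, LinearMap.mem_ker, Matrix.entryLinearMap_apply, mem_nt_iff_isStrictUpper]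

/-- `H_t` is a proper subspace of `𝔫` (the unit `E_{t,t+1}` is missing). [folklore] -/
theorem nt_inf_ker_entry_lt_nt {k : ℕ} (t : Fin k) :
    nt ℂ (k + 1) ⊓ LinearMap.ker (Matrix.entryLinearMap ℂ ℂ (Fin.castSucc t) (Fin.succ t)) < nt ℂ (k + 1) := by
  refine lt_of_le_of_ne inf_le_left fun hEq => ?_
  have hE : Matrix.single (Fin.castSucc t) (Fin.succ t) (1 : ℂ) ∈ nt ℂ (k + 1) := by
    rw [mem_nt_iff_isStrictUpper]
    intro i j hij
    rw [Matrix.single_apply, if_neg]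
    rintro ⟨rfl, rfl⟩
    exact absurd hij (not_le.2 (Fin.castSucc_lt_succ (i := t)))
  rw [← hEq, mem_nt_inf_ker_entry] at hE
  simpa using hE.2

/-- `dim H_t = C(k+1, 2) − 1`. [folklore] -/
theorem finrank_nt_inf_ker_entry {k : ℕ} (t : Fin k) :
    Module.finrank ℂ ↥(nt ℂ (k + 1) ⊓ LinearMap.ker (Matrix.entryLinearMap ℂ ℂ (Fin.castSucc t) (Fin.succ t))) = (k + 1).choose 2 - 1 := by
  classical
  set H := nt ℂ (k + 1) ⊓ LinearMap.ker (Matrix.entryLinearMap ℂ ℂ (Fin.castSucc t) (Fin.succ t)) with hH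
  -- upper bound: proper subspace of `𝔫`
  have h1 : Module.finrank ℂ H < (k + 1).choose 2 := by
    rw [← finrank_nt (K := ℂ) (k + 1)]; exact Submodule.finrank_lt_finrank_of_lt (nt_inf_ker_entry_lt_nt t)
  -- lower bound: `𝔫 ≤ H ⊔ ℂ E_{t,t+1}`
  set E : Matrix (Fin (k + 1)) (Fin (k + 1)) ℂ := Matrix.single (Fin.castSucc t) (Fin.succ t) (1 : ℂ) with hEdef
  have hEsu : IsStrictUpper E := by
    intro i j hij
    rw [hEdef, Matrix.single_apply, if_neg]
    rintro ⟨rfl, rfl⟩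
    exact absurd hij (not_le.2 (Fin.castSucc_lt_succ (i := t)))
  have hle : nt ℂ (k + 1) ≤ H ⊔ Submodule.span ℂ {E} := by
    intro A hA
    rw [mem_nt_iff_isStrictUpper] at hA
    have hsplit : A = (A - A t.castSucc t.succ • E) + A t.castSucc t.succ • E := by rw [sub_add_cancel]
    rw [hsplit]
    refine Submodule.add_mem _ (Submodule.mem_sup_left ?_) (Submodule.mem_sup_right (Submodule.smul_mem _ _ (Submodule.mem_span_singleton_self E)))
    rw [hH, mem_nt_inf_ker_entry]
    refine ⟨fun i j hij => ?_, ?_⟩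
    · rw [Matrix.sub_apply, Matrix.smul_apply, hA i j hij, hEsu i j hij, smul_zero, sub_zero]
    · rw [Matrix.sub_apply, Matrix.smul_apply, hEdef, Matrix.single_apply_same, smul_eq_mul, mul_one, sub_self]
  have h2 : (k + 1).choose 2 ≤ Module.finrank ℂ H + 1 := by
    calc (k + 1).choose 2 = Module.finrank ℂ (nt ℂ (k + 1)) := (finrank_nt (K := ℂ) (k + 1)).symm
      _ ≤ Module.finrank ℂ ↥(H ⊔ Submodule.span ℂ {E}) := Submodule.finrank_mono hle
      _ ≤ Module.finrank ℂ H + Module.finrank ℂ (Submodule.span ℂ {E}) := Submodule.finrank_add_le_finrank_add_finrank _ _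
      _ ≤ Module.finrank ℂ H + 1 := by
          gcongr
          exact (finrank_span_le_card ({E} : Set (Matrix (Fin (k + 1)) (Fin (k + 1)) ℂ))).trans (by simp)
  omega

/-! ## ★ Hyperplanes of `𝔫` of nilindex `< size` are coordinate hyperplanes -/

/-- ★ **A hyperplane `U` of `𝔫_{k+1}` with `A ^ k = 0` for all `A ∈ U` is a coordinate hyperplane `H_t = {A ∈ 𝔫 : A_{t,t+1} = 0}`.**
(`(A ^ k)_{0k} = ∏_t A_{t,t+1}` vanishes on `U`; a finite family of linear forms each non-zero on `U` has a common good vector; dimension count.)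
[folklore; lead CENSUS-EXTREMISERS X16 LEMMA T2, case d = 1] -/
theorem strictUpper_hyperplane_of_pow_eq_zero {k : ℕ} (U : Submodule ℂ (Matrix (Fin (k + 1)) (Fin (k + 1)) ℂ))
    (hU : ∀ A ∈ U, IsStrictUpper A) (hdim : Module.finrank ℂ U = (k + 1).choose 2 - 1) (hpow : ∀ A ∈ U, A ^ k = 0) :
    ∃ t : Fin k, ∀ A, A ∈ U ↔ IsStrictUpper A ∧ A t.castSucc t.succ = 0 := by
  classical
  -- (1) some superdiagonal coordinate vanishes identically on `U`
  obtain ⟨t, ht⟩ : ∃ t : Fin k, ∀ A ∈ U, A t.castSucc t.succ = 0 := by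
    by_contra hne
    push Not at hne
    obtain ⟨A, hA, hAk⟩ := exists_mem_forall_superdiag_ne_zero U hne k
    have hprod : ∏ t : Fin k, A t.castSucc t.succ ≠ 0 := Finset.prod_ne_zero_iff.2 fun t _ => hAk t t.isLt
    exact hprod ((pow_eq_zero_iff_prod_superdiag_eq_zero A (hU A hA)).1 (hpow A hA))
  refine ⟨t, ?_⟩
  -- (2) `U ≤ H_t`, equal dimensions
  have hUH : U ≤ nt ℂ (k + 1) ⊓ LinearMap.ker (Matrix.entryLinearMap ℂ ℂ (Fin.castSucc t) (Fin.succ t)) :=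
    fun A hA => (mem_nt_inf_ker_entry t A).2 ⟨hU A hA, ht A hA⟩
  have hUeq := Submodule.eq_of_le_of_finrank_eq hUH (by rw [hdim, finrank_nt_inf_ker_entry])
  intro A
  rw [hUeq, mem_nt_inf_ker_entry]

/-! ## ★★ The nilindex corollary -/

/-- The irreducible-plane form of ✓ `towerHull_exists_pow_ne_zero`: for an irreducible nilpotent `I ≤ M₃(ℂ)`, the tower `T(p, I, q)` contains an
element `B` with `B ^ (p + q + 2) ≠ 0` (nilindex `p + q + 3`). [this cell] -/
theorem towerHull_exists_pow_ne_zero_of_irreducible (p q : ℕ) (I : Submodule ℂ (Matrix (Fin 3) (Fin 3) ℂ))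
    (hInil : ∀ X ∈ I, IsNilpotent X) (hIirr : ∀ W : Submodule ℂ (Fin 3 → ℂ), (∀ X ∈ I, ∀ x ∈ W, X *ᵥ x ∈ W) → W = ⊥ ∨ W = ⊤) :
    ∃ B ∈ towerHull p q I, B ^ (p + q + 2) ≠ 0 := by
  obtain ⟨N, hN, hN2⟩ := exists_sq_ne_zero_of_irreducible (by norm_num) I hInil hIirr
  exact towerHull_exists_pow_ne_zero p q I hN hN2

/-- ★★ **THE NILINDEX COROLLARY (lead EXTREMISERS X16 R-d1; Macdonald–MacDougall–Sweet equality case at nilindex `m − 1`, classified).**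
For `m ≥ 2` and a linear space `V ≤ M_m(ℂ)` with `A ^ (m − 1) = 0` for all `A ∈ V` and `dim V = C(m,2) − 1`, there are a unit `P` and
consecutive indices `j = i + 1` such that `A ∈ V ↔ P A P⁻¹` is strictly upper triangular with `(P A P⁻¹)_{ij} = 0`: `V` is conjugate ONTO the
coordinate hyperplane `𝔫_m ∖ {E_{i,i+1}}`.  Sharp by `finrank_nt_inf_ker_entry` / `pow_eq_zero_of_superdiag_eq_zero`.  Enemy-side structure; not a
proof of `HeavyTopLaw`, 24318 or `VP ≠ VNP`. [COROLLARY II ✓ p722829 + this file; this cell] -/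
theorem nilIndex_codimOne_classification {m : ℕ} (hm : 2 ≤ m) (V : Submodule ℂ (Matrix (Fin m) (Fin m) ℂ))
    (hV : ∀ A ∈ V, A ^ (m - 1) = 0) (hdim : Module.finrank ℂ V = m.choose 2 - 1) :
    ∃ P : Matrix (Fin m) (Fin m) ℂ, IsUnit P ∧ ∃ i j : Fin m, (j : ℕ) = i + 1 ∧
      ∀ A, A ∈ V ↔ IsStrictUpper (P * A * P⁻¹) ∧ (P * A * P⁻¹) i j = 0 := by
  classical
  obtain ⟨k, rfl⟩ : ∃ k, m = k + 1 := ⟨m - 1, by omega⟩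
  simp only [Nat.add_sub_cancel] at hV
  have hVnil : ∀ A ∈ V, IsNilpotent A := fun A hA => ⟨k, hV A hA⟩
  rcases codimOne_classification hm V hVnil hdim with ⟨P, hP, hPV⟩ | ⟨p, q, e, I, P, hP, -, hInil, hIirr, hmem⟩
  · have hPdet : IsUnit P.det := (Matrix.isUnit_iff_isUnit_det P).1 hP
    -- the conjugated space `U = P V P⁻¹ ≤ 𝔫`
    set U : Submodule ℂ (Matrix (Fin (k + 1)) (Fin (k + 1)) ℂ) :=
      V.map (conjEquiv P hPdet : Matrix (Fin (k + 1)) (Fin (k + 1)) ℂ →ₗ[ℂ] Matrix (Fin (k + 1)) (Fin (k + 1)) ℂ) with hUdef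
    have hφ : ∀ A, conjEquiv P hPdet A = P * A * P⁻¹ := fun A => rfl
    have hmemU : ∀ A, A ∈ V ↔ P * A * P⁻¹ ∈ U := fun A => by
      rw [← hφ, hUdef, Submodule.mem_map_equiv, LinearEquiv.symm_apply_apply]
    have hUsu : ∀ B ∈ U, IsStrictUpper B := by
      rintro B ⟨A, hA, rfl⟩; exact hPV A hA
    have hUdim : Module.finrank ℂ U = (k + 1).choose 2 - 1 := by rw [hUdef, LinearEquiv.finrank_map_eq]; exact hdim
    have hUpow : ∀ B ∈ U, B ^ k = 0 := by
      rintro B ⟨A, hA, rfl⟩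
      show (conjEquiv P hPdet A) ^ k = 0
      rw [hφ, conj_pow P hPdet, hV A hA, Matrix.mul_zero, Matrix.zero_mul]
    obtain ⟨t, ht⟩ := strictUpper_hyperplane_of_pow_eq_zero U hUsu hUdim hUpow
    refine ⟨P, hP, t.castSucc, t.succ, by simp, fun A => ?_⟩
    rw [hmemU, ht]
  · exfalso
    obtain ⟨N, hN, hN2⟩ := exists_sq_ne_zero_of_irreducible (by norm_num) I hInil hIirr
    obtain ⟨A, hA, hAk⟩ := exists_pow_ne_zero_of_tower_form e I hN hN2 P hP V hmem
    exact hAk (by rw [Nat.add_sub_cancel]; exact hV A hA)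

end Summit.ValiantsHypothesis.ValiantsHypothesis.Theorems.GrenetZeon.HeavyTopNilIndexCodimOne

end
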